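import Summits.AtomisticToContinuum.Crystallization.Theorems.OverbindingBudgetAffineCompressedCutEstablish
import Summits.AtomisticToContinuum.Crystallization.Theorems.OverbindingBudgetAffinePhaseCutA

/-!
# `OverbindingBudget` / crux `RobustDefectLimitWindows` (stmt-AtomisticToContinuum-31280) — «RunCut»: LETTERS OF ESTABLISHED SITES (class ↔ pattern ↔ `HFramed`)

Support file (lens-4 g87, part 11; memo `g87/memo/SW-CHI.md` §10.5 (T2) and §10.8).  The typing glue between the layer-rigidity datum (classes `Cz ℓ` of the aligned copies
`fccL, fccNegL, hcpL, hcpAltL`), the chart datum (patterns `P m ∈ {fcc, hcp}` with affine frames) and the leaf's letter predicates `HFramed` / `HNear` of `…AffinePhaseCut`: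

* §1 `fccL_pair_tsq`/`carries_fcc_class` — an isometry cannot carry the fcc two-shell pattern onto `hcpL`/`hcpAltL` (those contain a pair at model distance² `48`, the fcc pattern —
  listed by `fccL` — has none): with `…RunCutAtlasAxis.carries_hcp_class` (part 10) CLASS and PATTERN of an established site determine each other;
* §2 `hFramed_of_chart` — a chart of an h-site at tolerances `(η, θ)` with `η + θ ≤ ε` is an `HFramed ε g` witness (the isometry `Q` of the chart, the same matching `f`);
  `hNear_of_chart` — hence an h-charted site within `r·ν_j` of `j` gives `HNear r ε g y j`;
* §3 ★ `chart_pattern_fcc_of_not_hNear` — under the leaf's `¬ HNear rh (3/50) (1/450) y j`, every charted site `m` with `dist (y m) (y j) ≤ rh·ν_j` has `P m = fccTwoShellPattern`,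
  and ★ `estab_class_fcc_of_not_hNear` — every site established there (in any datum) has an fcc class: the levels of the pivot's datum that carry a site within `rh·ν_j` are
  c-levels.  (The metric step «levels `|ℓ| ≤ 2` carry a site within `2ν_j`» is (T2)'s remaining half, memo §10.8.)
[this file: 0 definitions, 6 theorems; imports `…CompressedCutEstablish`, `…AffinePhaseCutA` (tree); standard axioms]
-/

namespace Summit.AtomisticToContinuum.Crystallization.Theorems.OverbindingBudgetAffineRunCutLetter

open Literature.Geometry.DiscreteGeometry (nearestDist nearestDist_nonneg fccTwoShellPattern hcpTwoShellPattern)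
open Summit.AtomisticToContinuum.Crystallization.Theorems.OverbindingBudgetAffineCompressedCutKernel (T3 tsub tsq fccL fccNegL hcpL hcpAltL)
open Summit.AtomisticToContinuum.Crystallization.Theorems.OverbindingBudgetAffineCompressedCutCharts (mv mv_tsub norm_mv_sq ListedBy Carries listedBy_fcc)
open Summit.AtomisticToContinuum.Crystallization.Theorems.OverbindingBudgetAffineCompressedCutEstablish (Estab)
open Summit.AtomisticToContinuum.Crystallization.Theorems.OverbindingBudgetAffinePhaseCut (HFramed HNear)

variable {N : ℕ}

local notation "E3" => EuclideanSpace ℝ (Fin 3)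

/-! ## §1 The class of a c-site's level is an fcc copy -/

/-- No pair of `fccL` has squared model distance `48`; each of `hcpL`, `hcpAltL` has one. [this file · kind: computation] -/
theorem fccL_pair_tsq : (∀ V ∈ fccL, ∀ W ∈ fccL, tsq (tsub V W) ≠ 48) ∧ ∀ C ∈ [hcpL, hcpAltL], ∃ V ∈ C, ∃ W ∈ C, tsq (tsub V W) = 48 := by
  decide

/-- **The class of a c-site's level is an fcc copy**: an isometry carrying the fcc two-shell pattern onto one of the four aligned copies carries it onto `F⁺` or `F⁻`.
[this file · kind: proof] -/
theorem carries_fcc_class {M : E3 →ₗᵢ[ℝ] E3} {C : List T3} (hM : Carries M fccTwoShellPattern C) (hC : C ∈ [fccL, fccNegL, hcpL, hcpAltL]) :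
    C = fccL ∨ C = fccNegL := by
  simp only [List.mem_cons, List.not_mem_nil, or_false] at hC
  rcases hC with rfl | rfl | hC | hC
  · exact Or.inl rfl
  · exact Or.inr rfl
  all_goals
    exfalso
    have hC' : C ∈ [hcpL, hcpAltL] := by subst hC; simp
    obtain ⟨V, hV, W, hW, h48⟩ := fccL_pair_tsq.2 C hC'
    obtain ⟨v, hv, hMv⟩ := hM.2 V hV
    obtain ⟨w, hw, hMw⟩ := hM.2 W hW
    obtain ⟨V₀, hV₀, rfl⟩ := listedBy_fcc.1 v hv
    obtain ⟨W₀, hW₀, rfl⟩ := listedBy_fcc.1 w hw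
    have hnorm : ‖mv (tsub V₀ W₀)‖ ^ 2 = ‖mv (tsub V W)‖ ^ 2 := by
      rw [mv_tsub, mv_tsub, ← hMv, ← hMw, ← map_sub, M.norm_map]
    rw [norm_mv_sq, norm_mv_sq] at hnorm
    have h48' : (tsq (tsub V₀ W₀) : ℝ) = 48 := by
      have : (tsq (tsub V W) : ℝ) = 48 := by exact_mod_cast h48
      linarith
    exact fccL_pair_tsq.1 V₀ hV₀ W₀ hW₀ (by exact_mod_cast h48')

/-! ## §2 A chart of an h-site is an `HFramed` witness -/

/-- ★ **h-CHART ⇒ `HFramed`.**  If the hcp two-shell pattern is matched at `m` through an affine frame `A` that is `θ`-close to the isometry `Q` on the pattern, with matching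
tolerance `η·ν_m`, injectively and exhaustively out to `(3/2 + g)·ν_m`, and `η + θ ≤ ε`, then `HFramed ε g y m` (with the isometry `Q` and the same matching). [this file · kind: proof] -/
theorem hFramed_of_chart {y : Fin N → E3} {m : Fin N} {Q : E3 →ₗᵢ[ℝ] E3} {A : E3 →ₗ[ℝ] E3} {f : E3 → E3} {η θ ε g : ℝ}
    (hA : ∀ v ∈ hcpTwoShellPattern, ‖A v - Q v‖ ≤ θ)
    (hf : ∀ v ∈ hcpTwoShellPattern, f v ∈ Set.range y ∧ dist (f v) (y m + nearestDist y m • A v) ≤ η * nearestDist y m)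
    (hinj : Set.InjOn f ↑hcpTwoShellPattern)
    (hex : ∀ k : Fin N, k ≠ m → dist (y k) (y m) ≤ (3 / 2 + g) * nearestDist y m → ∃ v ∈ hcpTwoShellPattern, f v = y k)
    (hε : η + θ ≤ ε) : HFramed ε g y m := by
  refine ⟨Q, f, fun v hv => ⟨(hf v hv).1, ?_⟩, hinj, hex⟩
  have hν : 0 ≤ nearestDist y m := nearestDist_nonneg y m
  have h1 := (hf v hv).2
  have h2 : dist (y m + nearestDist y m • A v) (y m + nearestDist y m • (Q v : E3)) ≤ θ * nearestDist y m := by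
    rw [dist_eq_norm, add_sub_add_left_eq_sub, ← smul_sub, norm_smul, Real.norm_of_nonneg hν, mul_comm]
    exact mul_le_mul_of_nonneg_right (hA v hv) hν
  calc dist (f v) (y m + nearestDist y m • (Q v : E3))
      ≤ dist (f v) (y m + nearestDist y m • A v) + dist (y m + nearestDist y m • A v) (y m + nearestDist y m • (Q v : E3)) := dist_triangle _ _ _
    _ ≤ η * nearestDist y m + θ * nearestDist y m := add_le_add h1 h2
    _ = (η + θ) * nearestDist y m := by ring
    _ ≤ ε * nearestDist y m := mul_le_mul_of_nonneg_right hε hν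

/-- An h-charted site within `r·ν_j` of `j` makes `j` hexagonal-proximate: `HNear r ε g y j`. [this file · kind: glue] -/
theorem hNear_of_chart {y : Fin N → E3} {j m : Fin N} {Q : E3 →ₗᵢ[ℝ] E3} {A : E3 →ₗ[ℝ] E3} {f : E3 → E3} {η θ ε g r : ℝ}
    (hA : ∀ v ∈ hcpTwoShellPattern, ‖A v - Q v‖ ≤ θ)
    (hf : ∀ v ∈ hcpTwoShellPattern, f v ∈ Set.range y ∧ dist (f v) (y m + nearestDist y m • A v) ≤ η * nearestDist y m)
    (hinj : Set.InjOn f ↑hcpTwoShellPattern)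
    (hex : ∀ k : Fin N, k ≠ m → dist (y k) (y m) ≤ (3 / 2 + g) * nearestDist y m → ∃ v ∈ hcpTwoShellPattern, f v = y k)
    (hε : η + θ ≤ ε) (hd : dist (y m) (y j) ≤ r * nearestDist y j) : HNear r ε g y j :=
  ⟨m, hd, hFramed_of_chart hA hf hinj hex hε⟩

/-! ## §3 Under `¬ HNear rh`: the sites charted within `rh·ν_j` are c-sites, their classes fcc copies -/

/-- ★ **NO h-PATTERN NEAR A NON-PROXIMATE SITE.**  Chart data on a set of sites containing `m` (patterns `P`, affine frames `A` `1/1000`-close to isometries `Qf`, matchings `f`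
at `1/10⁴`, exhaustive at `3/2 + 1/450`): if `¬ HNear rh (3/50) (1/450) y j` and `dist (y m) (y j) ≤ rh·ν_j`, then `P m = fccTwoShellPattern`. [this file · kind: proof] -/
theorem chart_pattern_fcc_of_not_hNear {y : Fin N → E3} {j m : Fin N} {P : Fin N → Finset E3} {A : Fin N → (E3 →ₗ[ℝ] E3)} {Qf : Fin N → (E3 →ₗᵢ[ℝ] E3)}
    {f : Fin N → E3 → E3} {rh : ℝ}
    (hP : P m = fccTwoShellPattern ∨ P m = hcpTwoShellPattern)
    (hA : ∀ v ∈ P m, ‖A m v - Qf m v‖ ≤ 1 / 1000)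
    (hf : ∀ v ∈ P m, f m v ∈ Set.range y ∧ dist (f m v) (y m + nearestDist y m • A m v) ≤ 1 / 10 ^ 4 * nearestDist y m)
    (hinj : Set.InjOn (f m) ↑(P m))
    (hex : ∀ k : Fin N, k ≠ m → dist (y k) (y m) ≤ (3 / 2 + 1 / 450) * nearestDist y m → ∃ v ∈ P m, f m v = y k)
    (hn : ¬ HNear rh (3 / 50) (1 / 450) y j) (hd : dist (y m) (y j) ≤ rh * nearestDist y j) : P m = fccTwoShellPattern := by
  rcases hP with h | h
  · exact h
  · exfalso
    rw [h] at hA hf hinj hex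
    exact hn (hNear_of_chart hA hf hinj hex (by norm_num) hd)

/-- ★ **CLASSES NEAR A NON-PROXIMATE SITE ARE fcc COPIES.**  Same chart data; a site `m` within `rh·ν_j` of `j` that is ESTABLISHED in some datum (`Estab y A P B i m M C lam τ D`)
with a class among the four aligned copies has `C = fccL ∨ C = fccNegL`. [this file · kind: proof] -/
theorem estab_class_fcc_of_not_hNear {y : Fin N → E3} {j m i : Fin N} {P : Fin N → Finset E3} {A : Fin N → (E3 →ₗ[ℝ] E3)} {Qf : Fin N → (E3 →ₗᵢ[ℝ] E3)}
    {f : Fin N → E3 → E3} {rh : ℝ} {B : E3 →ₗ[ℝ] E3} {M : E3 →ₗᵢ[ℝ] E3} {C : List T3} {lam : T3} {τ D : ℝ}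
    (hP : P m = fccTwoShellPattern ∨ P m = hcpTwoShellPattern)
    (hA : ∀ v ∈ P m, ‖A m v - Qf m v‖ ≤ 1 / 1000)
    (hf : ∀ v ∈ P m, f m v ∈ Set.range y ∧ dist (f m v) (y m + nearestDist y m • A m v) ≤ 1 / 10 ^ 4 * nearestDist y m)
    (hinj : Set.InjOn (f m) ↑(P m))
    (hex : ∀ k : Fin N, k ≠ m → dist (y k) (y m) ≤ (3 / 2 + 1 / 450) * nearestDist y m → ∃ v ∈ P m, f m v = y k)
    (hn : ¬ HNear rh (3 / 50) (1 / 450) y j) (hd : dist (y m) (y j) ≤ rh * nearestDist y j)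
    (hE : Estab y A P B i m M C lam τ D) (hC : C ∈ [fccL, fccNegL, hcpL, hcpAltL]) : C = fccL ∨ C = fccNegL := by
  have hPm := chart_pattern_fcc_of_not_hNear hP hA hf hinj hex hn hd
  have hc := hE.1
  rw [hPm] at hc
  exact carries_fcc_class hc hC

end Summit.AtomisticToContinuum.Crystallization.Theorems.OverbindingBudgetAffineRunCutLetter
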